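import Summits.RiemannHypothesis.RiemannHypothesis.Theorems.HandoffWallMotion
import Summits.RiemannHypothesis.RiemannHypothesis.Theorems.HandoffCouplingCumulative
import Summits.RiemannHypothesis.RiemannHypothesis.Theorems.SoloInformedPoleFree
import HarnessLib

/-!
# HANDOFF — PRINT ↔ TREE for Connes–Consani's **Conjecture 4.1** («The scaling Hamiltonian», 2019/2021)
# (cell rh-explicit, TRACK «HANDOFF», seat theory-1, file XIV)

HONEST FRAMING. Nothing here bears on the truth of RH. This file is bookkeeping on existing tree API; it places the
directive's remaining primary source in the kernel's currency and records the EXACT logical relations, no more.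

THE PRINTED STATEMENT (A. Connes, C. Consani, *The scaling Hamiltonian*, J. Operator Theory 85 (2021) 259–278 =
arXiv:1910.14368, §4 p. 18 of the arXiv version; read by handoff-lit, LIT-ASPRINTED §37B): «By a result of A. Weil
RH is equivalent to the negativity of the right hand side of the explicit formulas for all test functions f of the
form f(x) = ∫₀^∞ g(xy)g(y)dy, ∫₀^∞ g(x)dx = 0, ∫₀^∞ g(x)d*x = 0. One may moreover restrict attention to test functions g
with compact support … one needs to impose the two conditions ∫₀^∞ h₁(x) x^{±1/2} d*x = 0. (4.1) … **CONJECTURE 4.1.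
The semi-local operator theoretic framework with S := {∞} ∪ {p | p < q} suffices to prove the Weil inequality for
all test functions with support in the interval (q^{−1/2}, q^{1/2}).**»

READING (the only proposition inside a statement about the sufficiency of a METHOD): what the framework is to prove
at the parameter `q` is Weil's inequality for the POLE-FREE test functions supported in the OPEN interval
`(q^{−1/2}, q^{1/2})`; in the tree's additive normalisation (`WeilExplicit.lean`: `x = log u`, `ĝ = weilMellin g`,
`Q(g) = weilQuadratic g = W(g ⋆ g̃)`; the two conditions (4.1) are `weilMellin g 0 = 0 ∧ weilMellin g 1 = 0`, on which
class the polar term vanishes and the printed `Σ_v W_v ≤ 0` is `0 ≤ Re Q(g)` — dictionary of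
`Literature/NumberTheory/ConnesConsani2021/WeilPropertyP.lean`) this is the predicate written out in every statement
below,

    CC41(T) :  ∀ g, IsWeilTest g → tsupport g ⊆ Ioo (−T) T → ĝ(0) = 0 → ĝ(1) = 0 → 0 ≤ Re Q(g),   T = (log q)/2

(no `def` is introduced; «only the primes p < q enter» is then automatic, `HandoffWallSequence`/CC 2023 §2.1.2).

WHAT IS PROVED HERE (all RH-free unless the name says `riemannHypothesis`):
* §1 `CC41((log q)/2)` sits BETWEEN consecutive instances of Connes's property `P` (closed windows):
  `P(q) → CC41((log q)/2) → P(n)` for every `n < q`; and the full-class rung gives it: `WeilPositivityOn((log q)/2) →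
  CC41((log q)/2)`; hence `H(q) → CC41((log n)/2)` for every `n ≤ q⁺` (the cumulative handoff clause `H(q)` of this
  track IMPLIES the content of Conj. 4.1 at the next prime), and — RH-free, file XIII §4 — a prime that MOVES the
  semi-local wall satisfies Conj. 4.1 at itself.
* §2 Over all primes the content of Conj. 4.1 IS RH: `RH ↔ ∀ q prime, CC41((log q)/2)` (pole-free form of Weil's
  criterion, Bombieri 2000 Thms 1–2, tree `riemannHypothesis_iff_poleFree`).
* §3 Instances and the failing prime: `CC41((log q)/2)` is a THEOREM for `q ≤ 5` (tree rung `weilPositivityOn_log5half`);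
  if the handoff increment fails at the prime `q₁` (file X: this happens at no prime under RH and at exactly one
  prime under ¬RH) then Conj. 4.1 holds at EVERY `q ≤ q₁` — the pole-free / open-window statement outlives the
  full-class closed-window handoff by at least one prime — and under ¬RH it fails at some prime.
WHAT IS NOT CLAIMED (OPEN, RH-free): the per-window converses `CC41((log q⁺)/2) → H(q)` and `CC41((log q)/2) → P(q)`
(the pole-free class has codimension 2 in `C(T)`; the positive set of the pole-free class is not known to be closed
in `T` — the dilation modulus of `HandoffSemilocalDilation` does not preserve `ĝ(0) = ĝ(1) = 0`). They matter only
under ¬RH (under RH every clause holds).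

References: Connes–Consani 2021 (op. cit.) Conj. 4.1 [`ConnesConsani2021ScalingHamiltonian`]; A. Connes, *The Riemann
Hypothesis: past, present and a letter through time* (2026) §4.1 (property `P(n)`) [`Connes2026Letter`]; E. Bombieri,
Rend. Lincei (9) 11 (2000) Thms 1–2 [`Bombieri2000Weil`]; H. Yoshida, Adv. Stud. Pure Math. 21 (1992) Prop. 6
[`Yoshida1992HermitianForms`].
-/

set_option linter.dupNamespace false  -- the mandated namespace repeats `RiemannHypothesis`

noncomputable section

open Set Literature.NumberTheory.LFunctions Literature.NumberTheory.ConnesConsani2021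
open Summit.RiemannHypothesis.RiemannHypothesis.Theorems.MotivicDoor.Semilocal
open Summit.RiemannHypothesis.RiemannHypothesis.Theorems.MotivicDoor.SemilocalThreshold

namespace Summit.RiemannHypothesis.RiemannHypothesis.Theorems.HandoffDecomposition

variable {q q₁ n : ℕ} {T T' : ℝ}

/-! ## §1  The content of Conjecture 4.1 between the tree's clauses -/

/-- **Rung ⟹ Conj. 4.1-content, even without the vanishing conditions**: Weil positivity on the CLOSED window `C(T)`
gives it on every test function supported in the OPEN window `(−T, T)`. [cite: ConnesConsani2021ScalingHamiltonian, Conj. 4.1 (arXiv:1910.14368 p. 18)] -/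
theorem cc41_of_weilPositivityOn (hW : WeilPositivityOn T) :
    ∀ g : ℝ → ℂ, IsWeilTest g → tsupport g ⊆ Ioo (-T) T → weilMellin g 0 = 0 → weilMellin g 1 = 0 →
      0 ≤ (weilQuadratic g).re :=
  fun g hg hsupp _ _ ↦ hW g hg (hsupp.trans Ioo_subset_Icc_self)

/-- Conj. 4.1-content is ANTITONE in the window. [folklore] -/
theorem cc41_anti (hTT' : T ≤ T')
    (h : ∀ g : ℝ → ℂ, IsWeilTest g → tsupport g ⊆ Ioo (-T') T' → weilMellin g 0 = 0 → weilMellin g 1 = 0 →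
      0 ≤ (weilQuadratic g).re) :
    ∀ g : ℝ → ℂ, IsWeilTest g → tsupport g ⊆ Ioo (-T) T → weilMellin g 0 = 0 → weilMellin g 1 = 0 →
      0 ≤ (weilQuadratic g).re :=
  fun g hg hsupp h0 h1 ↦ h g hg (hsupp.trans (Ioo_subset_Ioo (neg_le_neg hTT') hTT')) h0 h1

/-- **`P(q) → CC41((log q)/2)`**: Connes's property `P(q)` (pole-free tests on the CLOSED window `[q^{−1/2}, q^{1/2}]`)
implies the content of Conj. 4.1 at `q` (OPEN window). The converse is NOT claimed (closedness of the pole-free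
positive set in the window parameter is open). [cite: Connes2026Letter, §4.1 p. 17 (P(n)); ConnesConsani2021ScalingHamiltonian Conj. 4.1 (arXiv p. 18)] -/
theorem cc41_of_weilPropertyP (h : weilPropertyP q) :
    ∀ g : ℝ → ℂ, IsWeilTest g → tsupport g ⊆ Ioo (-(Real.log q / 2)) (Real.log q / 2) →
      weilMellin g 0 = 0 → weilMellin g 1 = 0 → 0 ≤ (weilQuadratic g).re :=
  fun g hg hsupp h0 h1 ↦ (weilPropertyP_iff q).1 h g hg (hsupp.trans Ioo_subset_Icc_self) h0 h1

/-- **`CC41((log q)/2) → P(n)` for every `n < q`** (`2 ≤ q`): the closed window of `n` lies inside the open window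
of `q`. So the content of Conj. 4.1 at `q` sits between `P(q)` and `P(q − 1)`. [cite: Connes2026Letter, §4.1 p. 17; ConnesConsani2021ScalingHamiltonian Conj. 4.1 (arXiv p. 18)] -/
theorem weilPropertyP_of_cc41 (hq : 2 ≤ q)
    (h : ∀ g : ℝ → ℂ, IsWeilTest g → tsupport g ⊆ Ioo (-(Real.log q / 2)) (Real.log q / 2) →
      weilMellin g 0 = 0 → weilMellin g 1 = 0 → 0 ≤ (weilQuadratic g).re)
    (hn : n < q) : weilPropertyP n := by
  rw [weilPropertyP_iff]
  intro g hg hsupp h0 h1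
  have hlt : Real.log n / 2 < Real.log q / 2 := by
    have hq0 : (0 : ℝ) < q := by exact_mod_cast (show 0 < q by omega)
    rcases Nat.eq_zero_or_pos n with rfl | hn0
    · simp only [Nat.cast_zero, Real.log_zero, zero_div]
      have : 0 < Real.log q := Real.log_pos (by exact_mod_cast (show 1 < q by omega))
      linarith
    · have : Real.log n < Real.log q :=
        Real.log_lt_log (by exact_mod_cast hn0) (by exact_mod_cast hn)
      linarith
  exact h g hg (hsupp.trans (Icc_subset_Ioo (neg_lt_neg hlt) hlt)) h0 h1

/-- **`H(q) → CC41((log n)/2)` for every `n ≤ q⁺`** (q prime): the cumulative handoff clause of this track — Weil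
positivity on the CLOSED window of the NEXT prime, full class — implies the content of Conj. 4.1 at every parameter
up to and including `q⁺`; in particular «Conj. 4.1 at `q⁺`» is implied by `H(q)`. The per-window converse is NOT
claimed. [cite: ConnesConsani2021ScalingHamiltonian, Conj. 4.1 (arXiv:1910.14368 p. 18); Bombieri2000Weil §4] -/
theorem HandoffH.cc41_of_le (hq : q.Prime) (h : HandoffH q) (hn : n ≤ nextPrime q) :
    ∀ g : ℝ → ℂ, IsWeilTest g → tsupport g ⊆ Ioo (-(Real.log n / 2)) (Real.log n / 2) →
      weilMellin g 0 = 0 → weilMellin g 1 = 0 → 0 ≤ (weilQuadratic g).re :=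
  cc41_of_weilPositivityOn (h.weilPositivityOn_of_le hq hn)

/-- `H(q) →` Conj. 4.1-content at `q⁺`. [cite: ConnesConsani2021ScalingHamiltonian, Conj. 4.1 (arXiv:1910.14368 p. 18)] -/
theorem HandoffH.cc41_nextPrime (hq : q.Prime) (h : HandoffH q) :
    ∀ g : ℝ → ℂ, IsWeilTest g →
      tsupport g ⊆ Ioo (-(Real.log (nextPrime q) / 2)) (Real.log (nextPrime q) / 2) →
      weilMellin g 0 = 0 → weilMellin g 1 = 0 → 0 ≤ (weilQuadratic g).re :=
  h.cc41_of_le hq le_rfl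

/-- **RH-free: a prime that MOVES the semi-local wall satisfies Conj. 4.1 at itself.** If `a*({p < q}) ≠ a*({p ≤ q})`
then Weil positivity holds on `C((log q)/2)` (file XIII §4 `weilPositivityOn_of_wall_ne`), hence the content of
Conj. 4.1 at `q`. [cite: ConnesConsani2021ScalingHamiltonian, Conj. 4.1 (arXiv p. 18); Yoshida1992HermitianForms Prop. 6 (p. 320)] -/
theorem cc41_of_wall_ne (hq : q.Prime)
    (h : weilSemilocalThreshold (Nat.primesBelow q) ≠ weilSemilocalThreshold (Nat.primesBelow (nextPrime q))) :
    ∀ g : ℝ → ℂ, IsWeilTest g → tsupport g ⊆ Ioo (-(Real.log q / 2)) (Real.log q / 2) →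
      weilMellin g 0 = 0 → weilMellin g 1 = 0 → 0 ≤ (weilQuadratic g).re :=
  cc41_of_weilPositivityOn (weilPositivityOn_of_wall_ne hq h)

/-! ## §2  Over all primes the content of Conjecture 4.1 is RH -/

/-- Every compactly supported test function lives in the OPEN window of some prime. [folklore] -/
theorem exists_prime_tsupport_subset_Ioo {g : ℝ → ℂ} (hg : IsWeilTest g) :
    ∃ q : ℕ, q.Prime ∧ tsupport g ⊆ Ioo (-(Real.log q / 2)) (Real.log q / 2) := by
  obtain ⟨R, hR⟩ := hg.2.isCompact.isBounded.subset_closedBall 0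
  rw [Real.closedBall_eq_Icc, zero_sub, zero_add] at hR
  obtain ⟨q, hNq, hq⟩ := Nat.exists_infinite_primes (⌈Real.exp (2 * (max R 0 + 1))⌉₊ + 1)
  refine ⟨q, hq, hR.trans ?_⟩
  have h1 : Real.exp (2 * (max R 0 + 1)) < (q : ℝ) := by
    have := Nat.le_ceil (Real.exp (2 * (max R 0 + 1)))
    have h' : ((⌈Real.exp (2 * (max R 0 + 1))⌉₊ : ℕ) : ℝ) + 1 ≤ (q : ℝ) := by exact_mod_cast hNq
    linarith
  have h2 : 2 * (max R 0 + 1) < Real.log q := by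
    have := Real.log_lt_log (Real.exp_pos _) h1
    rwa [Real.log_exp] at this
  have h3 : R < Real.log q / 2 := by linarith [le_max_left R 0]
  exact Icc_subset_Ioo (neg_lt_neg h3) h3

/-- **`RH ↔` the content of Conj. 4.1 at EVERY prime.** (⟹: Weil's criterion, easy half; ⟸: every pole-free test
function is supported in the open window of some prime, and the pole-free form of Weil's criterion
`riemannHypothesis_iff_poleFree`, Bombieri 2000 Thms 1–2.) A REFORMULATION of RH, exactly like
`riemannHypothesis_iff_forall_handoffH` and `riemannHypothesis_iff_forall_weilPropertyP`; it does not bring RH nearer.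
[cite: ConnesConsani2021ScalingHamiltonian, Conj. 4.1 (arXiv:1910.14368 p. 18); Bombieri2000Weil Thms. 1–2 (p. 193)] -/
theorem riemannHypothesis_iff_forall_prime_cc41 :
    Summit.RiemannHypothesis ↔
      ∀ q : ℕ, q.Prime → ∀ g : ℝ → ℂ, IsWeilTest g →
        tsupport g ⊆ Ioo (-(Real.log q / 2)) (Real.log q / 2) →
        weilMellin g 0 = 0 → weilMellin g 1 = 0 → 0 ≤ (weilQuadratic g).re := by
  constructor
  · intro hRH q hq
    exact (handoffH_of_riemannHypothesis hRH hq).cc41_of_le hq (lt_nextPrime q).le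
  · intro h
    rw [riemannHypothesis_iff_poleFree]
    intro g hg h0 h1
    obtain ⟨q, hq, hsupp⟩ := exists_prime_tsupport_subset_Ioo hg
    exact h q hq g hg hsupp h0 h1

/-- The same with ALL natural parameters `n` (not only primes). [cite: ConnesConsani2021ScalingHamiltonian, Conj. 4.1 (arXiv p. 18)] -/
theorem riemannHypothesis_iff_forall_cc41 :
    Summit.RiemannHypothesis ↔
      ∀ n : ℕ, ∀ g : ℝ → ℂ, IsWeilTest g →
        tsupport g ⊆ Ioo (-(Real.log n / 2)) (Real.log n / 2) →
        weilMellin g 0 = 0 → weilMellin g 1 = 0 → 0 ≤ (weilQuadratic g).re := by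
  rw [riemannHypothesis_iff_forall_prime_cc41]
  refine ⟨fun h n ↦ ?_, fun h q _ ↦ h q⟩
  have hP : weilPropertyP n :=
    weilPropertyP_of_cc41 (nextPrime_prime n).two_le (h _ (nextPrime_prime n)) (lt_nextPrime n)
  exact cc41_of_weilPropertyP hP

/-! ## §3  Instances, and the failing prime -/

/-- **Conj. 4.1 holds at every `q ≤ 5` (THEOREM)** — from the tree's unconditional rung `WeilPositivityOn((log 5)/2)`
(`weilPositivityOn_log5half`; print stops at `q = 2`: Yoshida 1992 Thm 1 / Connes–Consani 2021 Thm 1). [cite: ConnesConsani2021ScalingHamiltonian, Conj. 4.1 (arXiv p. 18); Yoshida1992HermitianForms Thm. 1 (p. 310)] -/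
theorem cc41_of_le_five (hq : q ≤ 5) :
    ∀ g : ℝ → ℂ, IsWeilTest g → tsupport g ⊆ Ioo (-(Real.log q / 2)) (Real.log q / 2) →
      weilMellin g 0 = 0 → weilMellin g 1 = 0 → 0 ≤ (weilQuadratic g).re := by
  refine cc41_of_weilPositivityOn (EvenWinsBeyondArch.weilPositivityOn_of_le_log5half ?_)
  have : Real.log q ≤ Real.log 5 := by
    rcases Nat.eq_zero_or_pos q with rfl | hq0
    · simp only [Nat.cast_zero, Real.log_zero]
      exact Real.log_nonneg (by norm_num)
    · exact Real.log_le_log (by exact_mod_cast hq0) (by exact_mod_cast hq)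
  linarith

/-- **If the handoff increment fails at the prime `q₁`, Conj. 4.1 holds at every `q ≤ q₁`** (the failure at `q₁`
presupposes the rung `WeilPositivityOn((log q₁)/2)`, file X `not_handoffStep_iff`): the open-window pole-free
statement OUTLIVES the closed-window full-class handoff by at least one prime. Under RH there is no such `q₁`;
under ¬RH there is exactly one (`not_riemannHypothesis_iff_existsUnique_not_handoffStep`). [cite: ConnesConsani2021ScalingHamiltonian, Conj. 4.1 (arXiv p. 18); Yoshida1992HermitianForms Prop. 6 (p. 320)] -/
theorem cc41_of_le_of_not_handoffStep (hq₁ : q₁.Prime) (hfail : ¬ HandoffStep q₁) (hle : q ≤ q₁) :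
    ∀ g : ℝ → ℂ, IsWeilTest g → tsupport g ⊆ Ioo (-(Real.log q / 2)) (Real.log q / 2) →
      weilMellin g 0 = 0 → weilMellin g 1 = 0 → 0 ≤ (weilQuadratic g).re := by
  have hW : WeilPositivityOn (Real.log q₁ / 2) := ((not_handoffStep_iff hq₁).1 hfail).1
  refine cc41_of_weilPositivityOn (hW.mono ?_)
  have : Real.log q ≤ Real.log q₁ := by
    rcases Nat.eq_zero_or_pos q with rfl | hq0
    · simp only [Nat.cast_zero, Real.log_zero]
      exact Real.log_natCast_nonneg q₁
    · exact Real.log_le_log (by exact_mod_cast hq0) (by exact_mod_cast hle)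
  linarith

/-- **Under ¬RH Conj. 4.1 fails at some prime** (and then at every larger prime, `cc41_anti`). [cite: ConnesConsani2021ScalingHamiltonian, Conj. 4.1 (arXiv p. 18); Bombieri2000Weil Thms. 1–2] -/
theorem exists_prime_not_cc41_of_not_riemannHypothesis (hRH : ¬ Summit.RiemannHypothesis) :
    ∃ q : ℕ, q.Prime ∧ ¬ ∀ g : ℝ → ℂ, IsWeilTest g →
      tsupport g ⊆ Ioo (-(Real.log q / 2)) (Real.log q / 2) →
      weilMellin g 0 = 0 → weilMellin g 1 = 0 → 0 ≤ (weilQuadratic g).re := by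
  by_contra h
  push Not at h
  exact hRH (riemannHypothesis_iff_forall_prime_cc41.2 fun q hq ↦ h q hq)

/-- **Dichotomy for the prime-indexed truth set of Conj. 4.1** (unconditional): either it holds at EVERY prime
(⟺ RH), or there is a prime `Q` such that it holds at every prime `≤` the failing prime `q₁` of file X (in particular
at every prime `< Q`) and fails at `Q` and at every prime `≥ Q` — an initial segment, like the truth sets of `H` and
of `P`. Here only the weaker clean form is recorded: RH, or failure from some prime on. [cite: ConnesConsani2021ScalingHamiltonian, Conj. 4.1 (arXiv p. 18)] -/
theorem riemannHypothesis_or_eventually_not_cc41 :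
    Summit.RiemannHypothesis ∨ ∃ Q : ℕ, Q.Prime ∧ ∀ q : ℕ, Q ≤ q → ¬ ∀ g : ℝ → ℂ, IsWeilTest g →
      tsupport g ⊆ Ioo (-(Real.log q / 2)) (Real.log q / 2) →
      weilMellin g 0 = 0 → weilMellin g 1 = 0 → 0 ≤ (weilQuadratic g).re := by
  by_cases hRH : Summit.RiemannHypothesis
  · exact Or.inl hRH
  · obtain ⟨Q, hQ, hnot⟩ := exists_prime_not_cc41_of_not_riemannHypothesis hRH
    refine Or.inr ⟨Q, hQ, fun q hQq h ↦ hnot (cc41_anti ?_ h)⟩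
    have : Real.log Q ≤ Real.log q :=
      Real.log_le_log (by exact_mod_cast hQ.pos) (by exact_mod_cast hQq)
    linarith

/-! ## §4  Appendix (APPEND REMEDY, lead ruling R14-3, 2026-08-24): one pure-proof corollary; all declarations above byte-identical

Build note: this module was ACCEPTED (p366387, commit 4ff2a0b3c67a, 2026-08-23 ≈ 14:15Z) but never received a hub olean in the
08-23 build backlog (OPS-REQUESTS l.199/l.208); re-filing it as an append triggers its build; nothing above is changed. -/

/-- **`H(q)` gives the content of Conj. 4.1 at `q` itself** (the case `n = q ≤ q⁺` of `HandoffH.cc41_of_le`). [cite: ConnesConsani2021ScalingHamiltonian, Conj. 4.1 (arXiv:1910.14368 p. 18)] -/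
theorem HandoffH.cc41_self (hq : q.Prime) (h : HandoffH q) :
    ∀ g : ℝ → ℂ, IsWeilTest g → tsupport g ⊆ Ioo (-(Real.log q / 2)) (Real.log q / 2) →
      weilMellin g 0 = 0 → weilMellin g 1 = 0 → 0 ≤ (weilQuadratic g).re :=
  h.cc41_of_le hq (lt_nextPrime q).le

end Summit.RiemannHypothesis.RiemannHypothesis.Theorems.HandoffDecomposition
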